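import Summits.CriticalPhenomena.PercolationContinuityZ3.Theses.PercPortalLadder
import Summits.CriticalPhenomena.PercolationContinuityZ3.Theorems.PercNearOneGluingNoHeavyLowerTailCSHTheoremOne
import Literature.Probability.Percolation.CoveringMonotonicity
import Literature.Probability.Percolation.ConnectivityProofs
import HarnessLib

/-!
# `PercPortalLadder.PortalGridRung` (stmt-CriticalPhenomena-14516) — SETTLED after continuity

Item `stmt-CriticalPhenomena-14516` of route `CriticalPhenomena/PercPortalLadder` (crux): the grid rung — two critical half-spaces riveted along the grid `Π_2` do not percolate at `p_c(ℤ³)`.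

Deleting edges of `ℤ³` can only lower `θ` (Lyons–Peres Thm 6.47 covering inequality `LyonsPeres647.theta_le_of_surjOn_neighborSet` with the identity map), and `θ_{ℤ³}(v, p_c) = θ_{ℤ³}(0, p_c) = 0` (p205010).  Adapted from the refuter's costume `Cruxes/PortalGridRung/Costume.lean` (`portalGridRung_of_continuity`, spacing `k = 2`).

builds on p205010 (kernel theorem, internal audit signed; external expert review pending) — USED (`CSH.percolationContinuityZ3_holds`).  RSW3 lane, lead gen 28 (prover-prim-rsw3-lead-g28-0):
'after continuity — the ledger harvest'.
References: G. Kozma, N. Nitzan (2024), Thm. 6 / Conj. 3 [KozmaNitzan2024]; G. Grimmett, *Percolation* (1999), §8 [GrimmettPercolation1999].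
-/

noncomputable section

namespace Summit.CriticalPhenomena.PercolationContinuityZ3.Theorems

namespace PercPortalLadderPortalGridRung

open MeasureTheory Literature.Probability.Percolation Literature.Probability.LatticeModels

/-- **`PercPortalLadder.PortalGridRung` (stmt-CriticalPhenomena-14516), settled.**  witness `k = 2`: `θ_{ℤ³∖W}(v, p_c) ≤ θ_{ℤ³}(v, p_c) = 0`.
[cite: KozmaNitzan2024, Thm. 6 with Conj. 3 (p. 15)] -/
theorem portalGridRung_proof : Summit.CriticalPhenomena.PercolationContinuityZ3.Theses.PercPortalLadder.PortalGridRung := by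
  refine ⟨2, le_rfl, fun v => ?_⟩
  have h0 : theta (zdGraph 3) (0 : Site 3) (criticalProbI 3) = 0 := CSH.percolationContinuityZ3_holds
  refine le_antisymm ?_ measureReal_nonneg
  have hle : theta ((zdGraph 3).deleteEdges {e | ∃ x : Site 3, x 0 = 0 ∧ x ∉ {y : Site 3 | ((2 : ℕ) : ℤ) ∣ y 1 ∧ ((2 : ℕ) : ℤ) ∣ y 2} ∧
      e = s(x, x - Pi.single 0 1)}) v (criticalProbI 3) ≤ theta (zdGraph 3) v (criticalProbI 3) := by
    refine LyonsPeres647.theta_le_of_surjOn_neighborSet (zdGraph 3) _ id (fun x => ?_) v (criticalProbI 3)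
    intro y hy
    refine ⟨y, ?_, rfl⟩
    rw [SimpleGraph.mem_neighborSet, SimpleGraph.deleteEdges_adj] at hy
    rw [SimpleGraph.mem_neighborSet]
    exact hy.1
  calc _ ≤ theta (zdGraph 3) v (criticalProbI 3) := hle
    _ = theta (zdGraph 3) (0 : Site 3) (criticalProbI 3) := theta_zdGraph_eq_theta_zero _ _
    _ = 0 := h0

end PercPortalLadderPortalGridRung

end Summit.CriticalPhenomena.PercolationContinuityZ3.Theorems

end
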